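import Literature.AlgebraicTopology.SingularHomology.HurewiczOne
import Mathlib.Topology.Instances.AddCircle.Defs
import HarnessLib

/-!
# A loop freely homotopic to its own reverse has `2`-torsion Hurewicz class

Helper layer `helper_timelike_loopReversal` (generic, homological part) of stub
`helper_foldNF_timelike` (the untwistedness of the round `1`-handle of a genus-one simplified
broken Lefschetz fibration), line `Sketch`, crux `SblfDescent.RungOne`.

(Crux item stmt-SmoothPoincare4-18531; skeleton `Cruxes/RungOne/Lines/Sketch.lean`.)

In the twisted alternative of the nappe dichotomy the vanishing cycle of the round circle comes
back, after one turn, traversed backwards (Baykur–Kamada 2015, §2; Hayano 2011, §2.3): there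
are two continuous families of closed curves `L₁ (s, ·)`, `L₂ (s, ·)` (`1`-periodic in the
curve parameter) with `L₁ (1, ·) = L₂ (1, ·)` and `L₂ (0, θ) = L₁ (0, -θ)`.  This file records
the homological consequence (`helper_timelike_loopReversal`): the Hurewicz class
`h(γ) ∈ H₁(Y; ℤ)` of the loop `γ = L₁ (0, ·)|[0, 1]` satisfies `2 h(γ) = 0`.  Proof: descend the
families to maps `ℓ₀ ≃ ℓ₁ ≃ ℓ₂ = ℓ₀ ∘ (-1)` of the circle `ℝ/ℤ` (homotopy invariance of
`H₁`, Hatcher 2002, Thm. 2.10), and `h` of the reversed standard loop is `-h` (Hatcher 2002,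
Thm. 2A.1, the Hurewicz homomorphism).

## References

* A. Hatcher, *Algebraic Topology* (2002), Thm. 2.10, Thm. 2A.1. [HatcherAT2002]
* R. İ. Baykur, S. Kamada, *Classification of broken Lefschetz fibrations with small fiber
  genera*, J. Math. Soc. Japan 67 (2015), §2. [BaykurKamada2015]
-/

set_option linter.dupNamespace false

noncomputable section

open scoped Topology unitInterval
open Set Function Filter Literature.AlgebraicTopology.SingularHomology

namespace Summit.SmoothPoincare4.SmoothPoincare4.Cruxes.RungOne.Sketch

/-! ### Periodic families descend to the circle `ℝ/ℤ` -/

/-- **A continuous family of `1`-periodic curves descends to a continuous map on `ℝ × ℝ/ℤ`.**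
[folklore] -/
theorem exists_descend_periodic {Y : Type*} [TopologicalSpace Y] {L : ℝ × ℝ → Y}
    (hL : Continuous L) (hp : ∀ s θ, L (s, θ + 1) = L (s, θ)) :
    ∃ F : ℝ × (AddCircle (1 : ℝ)) → Y, Continuous F ∧ ∀ s θ : ℝ, F (s, (θ : (AddCircle (1 : ℝ)))) = L (s, θ) := by
  have hper : ∀ s : ℝ, Function.Periodic (fun θ => L (s, θ)) 1 := fun s θ => hp s θ
  refine ⟨fun q => (hper q.1).lift q.2, ?_, fun s θ => rfl⟩
  have hq : IsOpenQuotientMap (Prod.map id (QuotientAddGroup.mk : ℝ → (AddCircle (1 : ℝ)))) :=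
    (IsOpenQuotientMap.id : IsOpenQuotientMap (id : ℝ → ℝ)).prodMap
      QuotientAddGroup.isOpenQuotientMap_mk
  rw [hq.isQuotientMap.continuous_iff]
  exact hL

/-- The Hurewicz class is unchanged by recasting the endpoints of a loop. [folklore] -/
theorem loopClass_cast {Y : Type*} [TopologicalSpace Y] {y y' : Y} (γ : Path y y)
    (h : y' = y) : loopClass ℤ ℤ (1 : ℤ) (γ.cast h h) = loopClass ℤ ℤ (1 : ℤ) γ :=
  loopClass_eq_of_ofPath_eq ℤ ℤ (1 : ℤ) _ _ rfl

/-- **The Hurewicz class of a reversed loop is the opposite class** (`h` is a homomorphism and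
`γ · γ⁻¹ ≃ 1`). [cite: HatcherAT2002, Thm. 2A.1] -/
theorem loopClass_symm {Y : Type*} [TopologicalSpace Y] {y : Y} (γ : Path y y) :
    loopClass ℤ ℤ (1 : ℤ) γ.symm = -loopClass ℤ ℤ (1 : ℤ) γ := by
  have h1 : loopClass ℤ ℤ (1 : ℤ) (γ.trans γ.symm) = 0 := by
    rw [loopClass_eq_of_homotopic ℤ ℤ (1 : ℤ) ⟨(Path.Homotopy.reflTransSymm γ).symm⟩]
    exact loopClass_refl ℤ ℤ (1 : ℤ) y
  rw [loopClass_trans] at h1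
  exact eq_neg_of_add_eq_zero_right h1

/-! ### The reversal lemma -/

/-- **A loop that is freely homotopic to its own reverse has `2`-torsion Hurewicz class.**
Let `L₁, L₂ : ℝ × ℝ → Y` be continuous and `1`-periodic in the second variable, with
`L₁ (1, ·) = L₂ (1, ·)` and `L₂ (0, θ) = L₁ (0, -θ)`.  Then the loop `γ = L₁ (0, ·)|[0,1]`
has `2 h(γ) = 0` in `H₁(Y; ℤ)`. [cite: HatcherAT2002, Thm. 2.10 and Thm. 2A.1] -/
theorem helper_timelike_loopReversal : ∀ (Y : Type) [TopologicalSpace Y] (L₁ L₂ : ℝ × ℝ → Y), Continuous L₁ → Continuous L₂ → (∀ s θ : ℝ, L₁ (s, θ + 1) = L₁ (s, θ)) → (∀ s θ : ℝ, L₂ (s, θ + 1) = L₂ (s, θ)) → (∀ θ : ℝ, L₁ (1, θ) = L₂ (1, θ)) → (∀ θ : ℝ, L₂ (0, θ) = L₁ (0, -θ)) → ∀ (γ : Path (L₁ (0, 0)) (L₁ (0, 0))), (∀ τ : unitInterval, γ τ = L₁ (0, (τ : ℝ))) → (2 : ℤ) • loopClass ℤ ℤ (1 : ℤ) γ = 0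 := by
  intro Y _ L₁ L₂ h₁ h₂ hp₁ hp₂ h12 hrev γ hγ
  obtain ⟨F₁, hF₁, hF₁ap⟩ := exists_descend_periodic h₁ hp₁
  obtain ⟨F₂, hF₂, hF₂ap⟩ := exists_descend_periodic h₂ hp₂
  -- the three circle maps
  set ℓ₀ : C((AddCircle (1 : ℝ)), Y) := ⟨fun θ => F₁ (0, θ), hF₁.comp (continuous_const.prodMk continuous_id)⟩
    with hℓ₀
  set ℓ₁ : C((AddCircle (1 : ℝ)), Y) := ⟨fun θ => F₁ (1, θ), hF₁.comp (continuous_const.prodMk continuous_id)⟩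
    with hℓ₁
  set ℓ₂ : C((AddCircle (1 : ℝ)), Y) := ⟨fun θ => F₂ (0, θ), hF₂.comp (continuous_const.prodMk continuous_id)⟩
    with hℓ₂
  have hℓ₁' : ∀ θ : (AddCircle (1 : ℝ)), ℓ₁ θ = F₂ (1, θ) := by
    intro θ
    induction θ using QuotientAddGroup.induction_on with
    | H θ => change F₁ (1, (θ : (AddCircle (1 : ℝ)))) = F₂ (1, (θ : (AddCircle (1 : ℝ)))); rw [hF₁ap, hF₂ap, h12]
  -- `ℓ₀ ≃ ℓ₁ ≃ ℓ₂`
  have h01 : ℓ₀.Homotopic ℓ₁ := by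
    refine ⟨{ toFun := fun q => F₁ ((q.1 : ℝ), q.2)
              continuous_toFun := hF₁.comp (continuous_subtype_val.prodMap continuous_id)
              map_zero_left := fun θ => rfl
              map_one_left := fun θ => rfl }⟩
  have h21 : ℓ₂.Homotopic ℓ₁ := by
    refine ⟨{ toFun := fun q => F₂ ((q.1 : ℝ), q.2)
              continuous_toFun := hF₂.comp (continuous_subtype_val.prodMap continuous_id)
              map_zero_left := fun θ => rfl
              map_one_left := fun θ => (hℓ₁' θ).symm }⟩
  have h02 : ℓ₀.Homotopic ℓ₂ := h01.trans h21.symm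
  -- `ℓ₂ = ℓ₀ ∘ (-1)`
  set ng : C((AddCircle (1 : ℝ)), (AddCircle (1 : ℝ))) := ⟨fun θ => -θ, continuous_neg⟩ with hng
  have hℓ₂ng : ℓ₂ = ℓ₀.comp ng := by
    ext θ
    induction θ using QuotientAddGroup.induction_on with
    | H θ =>
      change F₂ (0, (θ : (AddCircle (1 : ℝ)))) = F₁ (0, -(θ : (AddCircle (1 : ℝ))))
      rw [← QuotientAddGroup.mk_neg, hF₁ap, hF₂ap, hrev]
  -- the standard loop `sl : τ ↦ [τ]` of `ℝ/ℤ`, and its reverse read through the negation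
  obtain ⟨sl, hsl⟩ : ∃ sl : Path (0 : (AddCircle (1 : ℝ))) (0 : (AddCircle (1 : ℝ))), ∀ τ : unitInterval, sl τ = ((τ : ℝ) : (AddCircle (1 : ℝ))) :=
    ⟨{ toFun := fun τ => ((τ : ℝ) : (AddCircle (1 : ℝ)))
       continuous_toFun := QuotientAddGroup.continuous_mk.comp continuous_subtype_val
       source' := by simp
       target' := by simp }, fun τ => rfl⟩
  have hslneg : sl.map ng.continuous = sl.symm.cast neg_zero neg_zero := by
    ext τ
    change ng (sl τ) = sl (unitInterval.symm τ)
    rw [hsl, hsl, unitInterval.coe_symm_eq, QuotientAddGroup.mk_sub, AddCircle.coe_period, zero_sub]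
    rfl
  -- the loop `γ` is the standard loop read through `ℓ₀`
  have h00 : L₁ (0, 0) = ℓ₀ 0 := by
    change L₁ (0, 0) = F₁ (0, ((0 : ℝ) : (AddCircle (1 : ℝ))))
    rw [hF₁ap]
  have hγsl : γ = (sl.map ℓ₀.continuous).cast h00 h00 := by
    ext τ
    rw [hγ τ]
    change L₁ (0, (τ : ℝ)) = F₁ (0, sl τ)
    rw [hsl, hF₁ap]
  set x := loopClass ℤ ℤ (1 : ℤ) sl with hx
  have hγx : loopClass ℤ ℤ (1 : ℤ) γ = singularHomology.map ℤ ℤ ℓ₀ 1 x := by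
    rw [hγsl, loopClass_cast, hx, map_loopClass]
  -- `ℓ₂_* x = - ℓ₀_* x`
  have hneg : singularHomology.map ℤ ℤ ℓ₂ 1 x = -singularHomology.map ℤ ℤ ℓ₀ 1 x := by
    rw [hℓ₂ng, singularHomology.map_comp, CategoryTheory.comp_apply, hx, map_loopClass,
      hslneg, loopClass_cast, loopClass_symm, map_neg]
  have heq : singularHomology.map ℤ ℤ ℓ₀ 1 x = singularHomology.map ℤ ℤ ℓ₂ 1 x := by
    rw [singularHomology.map_eq_of_homotopic ℤ ℤ h02]
  have hself : singularHomology.map ℤ ℤ ℓ₀ 1 x = -singularHomology.map ℤ ℤ ℓ₀ 1 x :=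
    heq.trans hneg
  rw [hγx, two_zsmul]
  nth_rewrite 2 [hself]
  exact add_neg_cancel _

end Summit.SmoothPoincare4.SmoothPoincare4.Cruxes.RungOne.Sketch

end
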